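import Literature.NumberTheory.Transcendental.QuadraticRelationsLogarithmsSec5Endgame
import Mathlib.FieldTheory.AlgebraicClosure
import Mathlib.LinearAlgebra.FreeModule.PID
import Mathlib.Algebra.EuclideanDomain.Int
import Mathlib.Logic.Equiv.Fintype
import HarnessLib

/-!
# Roy–Waldschmidt 1997, §5: `Y/Y_a` torsion-free and a basis of `Y` adapted to `Y_a`

D. Roy, M. Waldschmidt, Ann. Sci. ÉNS (4) 30 (1997) 753–796, proof of Théorème 5.1, p. 780:
"Soient `ℓ₀` la dimension de `W`, `ℓ₁` le rang de `Y` et `ℓ_a` le rang de `Y_a`. Quitte, par exemple,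
à remplacer `Y_a` par l'ensemble de tous les points `η ∈ Y` tels que
`exp_G(η) ∈ G₀(K) × G₁(K ∩ ℚ̄)`, on peut supposer que le quotient `Y/Y_a` est sans torsion. Cela
permet de compléter une base `{η₁, …, η_{ℓ_a}}` de `Y_a` en une base `{η₁, …, η_{ℓ₁}}` de `Y`."

PROVED here, for an object `X = (d₀, d₁, W, Y, Y_a)` (`RWObj`):

* `RWObj.YaSat` — the subgroup of all `η ∈ Y` with `exp(η^{(d₀+i)})` algebraic for all `i`
  (it contains `Y_a` and is *saturated* in `Y`: `kη ∈ Y_a^{sat}`, `k ≠ 0` ⟹ `η ∈ Y_a^{sat}`), and the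
  object `X.sat` obtained by replacing `Y_a` with it; for every subgroup `S`,
  `ℓ_a(X) - rang(Y_a ∩ S) ≤ ℓ_a(X.sat) - rang(Y_a^{sat} ∩ S)` (so the conclusion (5.1) for `X.sat`
  implies it for `X`, the term `-ε²λ_a'` being monotone);
* `RWObj.exists_adapted_basis` — **a `ℤ`-basis of `Y` whose first part is a basis of `Y_a^{sat}`**:
  `ℤ`-independent `η : Fin a ⊕ Fin c → T_G(ℂ)` with `∑ ℤηᵢ = Y` and `∑_{i = inl _} ℤηᵢ = Y_a^{sat}`
  (Smith normal form of `Y_a^{sat} ≤ Y ≅ ℤ^{ℓ₁}`; by saturation the elementary divisors are units).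

No named facts; the only definitions are `RWObj.YaSat` and `RWObj.sat` (bodies).

## References

* [RoyWaldschmidt1997ENS] D. Roy, M. Waldschmidt, Ann. Sci. ÉNS (4) 30 (1997) 753–796, proof of
  Théorème 5.1, p. 780.
-/

noncomputable section

open Complex IntermediateField Module Submodule

namespace Literature.NumberTheory.Transcendental

namespace RoyWaldschmidt1997

variable {K : IntermediateField ℚ ℂ}

namespace RWObj

/-! ### The saturation of `Y_a` -/

/-- The subgroup of `T_G(ℂ)` of the `η` with `exp(η^{(d₀+i)})` algebraic over `ℚ` for all `i`
(i.e. `exp_G(η) ∈ G₀ × G₁(ℚ̄)`). [folklore] -/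
def algExpSub (d₀ d₁ : ℕ) : Submodule ℤ ((Fin d₀ → ℂ) × (Fin d₁ → ℂ)) where
  carrier := {y | ∀ j, cexp (y.2 j) ∈ algebraicClosure ℚ ℂ}
  add_mem' := by
    intro a b ha hb j
    simp only [Prod.snd_add, Pi.add_apply, Complex.exp_add]
    exact mul_mem (ha j) (hb j)
  zero_mem' := by intro j; simp
  smul_mem' := by
    intro c a ha j
    show cexp (c • a.2 j) ∈ _
    rw [zsmul_eq_mul, Complex.exp_int_mul]
    exact zpow_mem (ha j) c

/-- Membership in `algExpSub`. [folklore] -/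
theorem mem_algExpSub {d₀ d₁ : ℕ} {y : (Fin d₀ → ℂ) × (Fin d₁ → ℂ)} :
    y ∈ algExpSub d₀ d₁ ↔ ∀ j, IsAlgebraic ℚ (cexp (y.2 j)) := by
  simp only [algExpSub, Submodule.mem_mk, AddSubmonoid.mem_mk, AddSubsemigroup.mem_mk, Set.mem_setOf_eq,
    mem_algebraicClosure_iff]

/-- **`Y_a^{sat}`: all `η ∈ Y` with `exp_G(η) ∈ G₀(K) × G₁(K ∩ ℚ̄)`** (p. 780).
[cite: RoyWaldschmidt1997ENS, proof of Théorème 5.1, p. 780] -/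
def YaSat (X : RWObj K) : Submodule ℤ ((Fin X.d₀ → ℂ) × (Fin X.d₁ → ℂ)) := X.Y ⊓ algExpSub X.d₀ X.d₁

/-- `Y_a ≤ Y_a^{sat}`. [folklore] -/
theorem Ya_le_YaSat (X : RWObj K) : X.Ya ≤ X.YaSat := by
  intro y hy
  refine ⟨X.hYa hy, ?_⟩
  rw [SetLike.mem_coe, mem_algExpSub]
  exact X.hYaL y hy

/-- `Y_a^{sat} ≤ Y`. [folklore] -/
theorem YaSat_le_Y (X : RWObj K) : X.YaSat ≤ X.Y := inf_le_left

/-- **Saturation**: `kη ∈ Y_a^{sat}` with `η ∈ Y`, `k ≠ 0` forces `η ∈ Y_a^{sat}` (a root of an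
algebraic number is algebraic). [cite: RoyWaldschmidt1997ENS, proof of Théorème 5.1, p. 780] -/
theorem mem_YaSat_of_smul_mem (X : RWObj K) {y : (Fin X.d₀ → ℂ) × (Fin X.d₁ → ℂ)} (hy : y ∈ X.Y)
    {k : ℤ} (hk : k ≠ 0) (hky : k • y ∈ X.YaSat) : y ∈ X.YaSat := by
  refine ⟨hy, ?_⟩
  have h2 := (mem_algExpSub.mp hky.2)
  rw [SetLike.mem_coe, mem_algExpSub]
  intro j
  have hj : IsAlgebraic ℚ (cexp (k • y.2 j)) := h2 j
  rw [zsmul_eq_mul, Complex.exp_int_mul] at hj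
  -- `exp(y_j)^k` algebraic, `k ≠ 0` ⟹ `exp(y_j)` algebraic
  rcases Int.natAbs_eq k with hk' | hk'
  · rw [hk', zpow_natCast] at hj
    exact IsAlgebraic.of_pow (Int.natAbs_pos.mpr hk) hj
  · rw [hk', zpow_neg, zpow_natCast] at hj
    have := hj.inv
    rw [inv_inv] at this
    exact IsAlgebraic.of_pow (Int.natAbs_pos.mpr hk) this

/-- **The object `X^{sat} = (d₀, d₁, W, Y, Y_a^{sat})`.** [cite: RoyWaldschmidt1997ENS, proof of Théorème 5.1, p. 780] -/
def sat (X : RWObj K) : RWObj K where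
  d₀ := X.d₀
  d₁ := X.d₁
  W := X.W
  hW := X.hW
  Y := X.Y
  hYfg := X.hYfg
  hY := X.hY
  Ya := X.YaSat
  hYa := X.YaSat_le_Y
  hYaL := fun _ hy j => (mem_algExpSub.mp hy.2) j

/-- `X^{sat}` has the same `d₀, d₁, W, Y`; its `Y_a` is `Y_a^{sat}`. [folklore] -/
@[simp] theorem sat_d₀ (X : RWObj K) : X.sat.d₀ = X.d₀ := rfl
/-- See `sat_d₀`. [folklore] -/
@[simp] theorem sat_d₁ (X : RWObj K) : X.sat.d₁ = X.d₁ := rfl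
/-- See `sat_d₀`. [folklore] -/
@[simp] theorem sat_W (X : RWObj K) : X.sat.W = X.W := rfl
/-- See `sat_d₀`. [folklore] -/
@[simp] theorem sat_Y (X : RWObj K) : X.sat.Y = X.Y := rfl
/-- See `sat_d₀`. [folklore] -/
@[simp] theorem sat_Ya (X : RWObj K) : X.sat.Ya = X.YaSat := rfl
/-- See `sat_d₀`. [folklore] -/
@[simp] theorem sat_ell₀ (X : RWObj K) : X.sat.ell₀ = X.ell₀ := rfl
/-- See `sat_d₀`. [folklore] -/
@[simp] theorem sat_ell₁ (X : RWObj K) : X.sat.ell₁ = X.ell₁ := rfl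
/-- See `sat_d₀`. [folklore] -/
@[simp] theorem sat_nn (X : RWObj K) : X.sat.nn = X.nn := rfl
/-- See `sat_d₀`. [folklore] -/
@[simp] theorem sat_kap (X : RWObj K) : X.sat.kap = X.kap := rfl
/-- See `sat_d₀`. [folklore] -/
theorem sat_ellA (X : RWObj K) : X.sat.ellA = Module.finrank ℤ X.YaSat := rfl

/-- **Monotonicity of `λ_a'` in `Y_a`**: for `Y_a ≤ Y_a' (≤ Y)` and any subgroup `S`,
`rang Y_a - rang(Y_a ∩ S) ≤ rang Y_a' - rang(Y_a' ∩ S)` (the quotient `Y_a/(Y_a ∩ S)` embeds in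
`Y_a'/(Y_a' ∩ S)`); in particular for `Y_a' = Y_a^{sat}`. [folklore] -/
theorem ellA_sub_le_sat (X : RWObj K) (S : Submodule ℤ ((Fin X.d₀ → ℂ) × (Fin X.d₁ → ℂ))) :
    X.ellA - Module.finrank ℤ ↥(X.Ya ⊓ S) ≤ X.sat.ellA - Module.finrank ℤ ↥(X.YaSat ⊓ S) := by
  classical
  let ψ : ((Fin X.d₀ → ℂ) × (Fin X.d₁ → ℂ)) →ₗ[ℤ] ((Fin X.d₀ → ℂ) × (Fin X.d₁ → ℂ)) ⧸ S := S.mkQ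
  have hker : LinearMap.ker ψ = S := Submodule.ker_mkQ S
  have hfg : X.YaSat.FG := X.sat.fg_Ya
  have h1 := finrank_map_add_finrank_inf_ker_int X.Ya X.fg_Ya ψ
  have h2 := finrank_map_add_finrank_inf_ker_int X.YaSat hfg ψ
  rw [hker] at h1 h2
  have hle : Module.finrank ℤ ↥(X.Ya.map ψ) ≤ Module.finrank ℤ ↥(X.YaSat.map ψ) :=
    finrank_le_of_le_fg (Submodule.map_mono X.Ya_le_YaSat) (hfg.map _)
  rw [sat_ellA]
  simp only [RWObj.ellA] at h1 h2 hle ⊢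
  omega

/-! ### A basis of `Y` adapted to `Y_a^{sat}` -/

/-- **A `ℤ`-basis of `Y` whose first part is a basis of `Y_a^{sat}`** ("compléter une base de `Y_a`
en une base de `Y`", possible as `Y/Y_a^{sat}` is torsion-free): a `ℤ`-independent family
`η : Fin a ⊕ Fin c → T_G(ℂ)` with `∑ᵢ ℤηᵢ = Y` and `∑ⱼ ℤη_{inl j} = Y_a^{sat}`; then `a = rang Y_a^{sat}`
and `a + c = rang Y`. [cite: RoyWaldschmidt1997ENS, proof of Théorème 5.1, p. 780] -/
theorem exists_adapted_basis (X : RWObj K) :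
    ∃ (a c : ℕ) (η : Fin a ⊕ Fin c → (Fin X.d₀ → ℂ) × (Fin X.d₁ → ℂ)),
      LinearIndependent ℤ η ∧ Submodule.span ℤ (Set.range η) = X.Y ∧
      Submodule.span ℤ (Set.range (η ∘ Sum.inl)) = X.YaSat ∧
      a = Module.finrank ℤ X.YaSat ∧ a + c = X.ell₁ := by
  classical
  haveI : Module.Finite ℤ X.Y := X.finite_Y
  haveI : Module.Free ℤ X.Y := Module.free_of_finite_type_torsion_free'
  -- a basis of `Y` indexed by `Fin ℓ₁`
  let b₀ := Module.Free.chooseBasis ℤ X.Y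
  let bY : Basis (Fin X.ell₁) ℤ X.Y := b₀.reindex (Fintype.equivFinOfCardEq (by
    rw [RWObj.ell₁, Module.finrank_eq_card_basis b₀]))
  -- `Y_a^{sat}` as a submodule of `Y`, and its Smith normal form
  set Na : Submodule ℤ X.Y := X.YaSat.comap X.Y.subtype with hNa
  obtain ⟨n, snf⟩ := Submodule.smithNormalForm bY Na
  -- saturation: the basis vectors `bM (f i)` lie in `Na`, and span it
  have hmem_f : ∀ i : Fin n, snf.bM (snf.f i) ∈ Na := by
    intro i
    have h1 : (snf.bN i : X.Y) = snf.a i • snf.bM (snf.f i) := snf.snf i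
    have ha : snf.a i ≠ 0 := by
      intro ha
      have : (snf.bN i : X.Y) = 0 := by rw [h1, ha, zero_smul]
      exact snf.bN.ne_zero i (Subtype.ext this)
    have hmem : snf.a i • snf.bM (snf.f i) ∈ Na := by rw [← h1]; exact (snf.bN i).2
    -- `Na = comap subtype YaSat`: membership is membership of the coercion in `YaSat`
    have hmem' : ((snf.a i • snf.bM (snf.f i) : X.Y) : (Fin X.d₀ → ℂ) × (Fin X.d₁ → ℂ)) ∈ X.YaSat := hmem
    rw [Submodule.coe_smul] at hmem'
    have hgoal : ((snf.bM (snf.f i) : X.Y) : (Fin X.d₀ → ℂ) × (Fin X.d₁ → ℂ)) ∈ X.YaSat :=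
      X.mem_YaSat_of_smul_mem (snf.bM (snf.f i)).2 ha hmem'
    exact hgoal
  have hNa_span : Na = Submodule.span ℤ (Set.range fun i => snf.bM (snf.f i)) := by
    apply le_antisymm
    · intro χ hχ
      have hrepr := snf.bM.sum_repr χ
      rw [← hrepr]
      refine Submodule.sum_mem _ fun k _ => ?_
      by_cases hk : k ∈ Set.range snf.f
      · obtain ⟨i, rfl⟩ := hk
        exact Submodule.smul_mem _ _ (Submodule.subset_span ⟨i, rfl⟩)
      · have : snf.bM.repr χ k = 0 := snf.repr_eq_zero_of_notMem_range ⟨χ, hχ⟩ hk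
        rw [this, zero_smul]
        exact Submodule.zero_mem _
    · exact Submodule.span_le.mpr (by rintro _ ⟨i, rfl⟩; exact hmem_f i)
  -- the complementary indices
  set C : Set (Fin X.ell₁) := (Set.range snf.f)ᶜ with hC
  let c : ℕ := Fintype.card C
  let eC : C ≃ Fin c := Fintype.equivFin C
  -- the family
  let η : Fin n ⊕ Fin c → (Fin X.d₀ → ℂ) × (Fin X.d₁ → ℂ) :=
    Sum.elim (fun i => (snf.bM (snf.f i) : (Fin X.d₀ → ℂ) × (Fin X.d₁ → ℂ)))
      (fun j => (snf.bM ((eC.symm j : C) : Fin X.ell₁) : (Fin X.d₀ → ℂ) × (Fin X.d₁ → ℂ)))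
  -- the index map `Fin n ⊕ Fin c → Fin ℓ₁` is a bijection
  let idx : Fin n ⊕ Fin c → Fin X.ell₁ := Sum.elim snf.f (fun j => ((eC.symm j : C) : Fin X.ell₁))
  have hidx_inj : Function.Injective idx := by
    rintro (i | j) (i' | j') h
    · simp only [idx, Sum.elim_inl] at h; rw [snf.f.injective h]
    · simp only [idx, Sum.elim_inl, Sum.elim_inr] at h
      have : ((eC.symm j' : C) : Fin X.ell₁) ∉ Set.range snf.f := (eC.symm j').2
      exact absurd ⟨i, h⟩ this
    · simp only [idx, Sum.elim_inl, Sum.elim_inr] at h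
      have : ((eC.symm j : C) : Fin X.ell₁) ∉ Set.range snf.f := (eC.symm j).2
      exact absurd ⟨i', h.symm⟩ this
    · simp only [idx, Sum.elim_inr] at h
      have := Subtype.ext h
      rw [Equiv.symm_apply_eq] at this
      rw [this, Equiv.apply_symm_apply]
  have hidx_surj : Function.Surjective idx := by
    intro k
    by_cases hk : k ∈ Set.range snf.f
    · obtain ⟨i, rfl⟩ := hk; exact ⟨Sum.inl i, rfl⟩
    · exact ⟨Sum.inr (eC ⟨k, hk⟩), by simp [idx]⟩
  let eidx : Fin n ⊕ Fin c ≃ Fin X.ell₁ := Equiv.ofBijective idx ⟨hidx_inj, hidx_surj⟩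
  have hη_eq : η = (fun k => (snf.bM k : (Fin X.d₀ → ℂ) × (Fin X.d₁ → ℂ))) ∘ eidx := by
    funext k; rcases k with i | j <;> rfl
  -- linear independence and spans
  have hbM_li : LinearIndependent ℤ (fun k => (snf.bM k : (Fin X.d₀ → ℂ) × (Fin X.d₁ → ℂ))) :=
    snf.bM.linearIndependent.map' X.Y.subtype (Submodule.ker_subtype _)
  have hli : LinearIndependent ℤ η := by
    rw [hη_eq]; exact hbM_li.comp _ eidx.injective
  have hspanY : Submodule.span ℤ (Set.range η) = X.Y := by
    rw [hη_eq, Set.range_comp, eidx.surjective.range_eq, Set.image_univ]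
    have : Set.range (fun k => (snf.bM k : (Fin X.d₀ → ℂ) × (Fin X.d₁ → ℂ))) = X.Y.subtype '' Set.range snf.bM := by
      rw [← Set.range_comp]; rfl
    rw [this, ← Submodule.map_span, snf.bM.span_eq, Submodule.map_top, Submodule.range_subtype]
  have hspanA : Submodule.span ℤ (Set.range (η ∘ Sum.inl)) = X.YaSat := by
    have : Set.range (η ∘ Sum.inl) = X.Y.subtype '' Set.range (fun i => snf.bM (snf.f i)) := by
      rw [← Set.range_comp]; rfl
    rw [this, ← Submodule.map_span, ← hNa_span, hNa, Submodule.map_comap_eq, Submodule.range_subtype,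
      inf_eq_right.mpr X.YaSat_le_Y]
  refine ⟨n, c, η, hli, hspanY, hspanA, ?_, ?_⟩
  · -- `n = rang Y_a^{sat}`
    have h1 : Module.finrank ℤ ↥(Submodule.span ℤ (Set.range (η ∘ Sum.inl))) = n := by
      rw [finrank_span_eq_card (hli.comp _ Sum.inl_injective), Fintype.card_fin]
    rw [hspanA] at h1
    exact h1.symm
  · -- `n + c = ℓ₁`
    have := Fintype.card_congr eidx
    simp only [Fintype.card_sum, Fintype.card_fin] at this
    exact this

end RWObj

end RoyWaldschmidt1997

end Literature.NumberTheory.Transcendental
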